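import Summits.AtomisticToContinuum.BoseEinsteinCondensation.Theorems.BECSubharmonicContinuationContinuationToPeriodicBECChain
import Summits.AtomisticToContinuum.BoseEinsteinCondensation.Theorems.BECSubharmonicContinuationFreeGasCase
import Literature.MathematicalPhysics.QuantumManyBody.BoseGasThermodynamicLimitRuelle
import HarnessLib

/-!
# Route `BECSubharmonicContinuation`, item `ContinuationToPeriodicBEC` (stmt-AtomisticToContinuum-14585):
# `SubharmonicCoherence → HealingScaleDeficit → PeriodicBEC`

The glue `X → Target` of the route, concluded BY NAME (`continuationToPeriodicBEC_proof`).

Proof. Fix an admissible `v`; its scattering length `a` is finite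
(`IsRepulsiveFiniteRange.scatteringLength_ne_top`). If `a = 0` the target is the landed support
`FreeGasCase` (`freeGasCase_proof`). If `a > 0`, take `M, ρ₁` from `SubharmonicCoherence` (S1) and
`ρ₂` from `HealingScaleDeficit` (S2) at `(M, ε = 1/9216)`, `ρ₀ = min ρ₁ ρ₂`, `c = 1/8`. For
`0 < ρ < ρ₀` and all large `N` (both eventualities, `N ≥ 1`, and `2Mξ ≤ L = (N/ρ)^{1/3}` by
`tendsto_sideLength_atTop`), with `δ = min δ₁ δ₂`, every `δ`-near-minimiser satisfies the S1 shell
bound and the S2 window bound at the particle `i = 0`, and the SPHERE-KERNEL CONTINUATION for one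
trial state (`SubharmonicContinuation.condensateOccupation_ge_of_shell_of_window`,
`…ContinuationToPeriodicBECChain.lean`: `∑ aₙ(1 − sinc|κₙ|L/2) = ∫_{B_{L/2}} H·W_{L/2} ≤ 192ε + 1/8`
with `W_S = (4π)⁻¹(1/|y| − 1/S)`, then `⨍_{B_{L/2}} G ≥ 9/16`, then the landed `BallCriterion`)
gives `condensateOccupation ≥ N/8`. No energy bound, Bose symmetry or positivity is used (the
sphere kernel has no `H(0)R³/S` middle term), so the LSSY upper bound enters only through
`FreeGasCase`.

References: LSSY 2005 §1.2, Ch. 5; the route file's thesis. No named facts are assumed.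
-/

noncomputable section

namespace Summit.AtomisticToContinuum.BoseEinsteinCondensation.Theorems

open MeasureTheory Filter Set Metric
open scoped ENNReal NNReal ComplexConjugate
open Literature.MathematicalPhysics.QuantumManyBody.BoseGas

/-- **`ContinuationToPeriodicBEC`** (item stmt-AtomisticToContinuum-14585 of route
BECSubharmonicContinuation, the main door `X → Target`): subharmonic coherence beyond `M` healing
lengths (S1) and healing-scale condensation (S2) imply constant-mode BEC for periodic
near-minimisers at all small densities, `PeriodicBEC`, with `c = 1/8`. [folklore] -/
theorem continuationToPeriodicBEC_proof :
    Summit.AtomisticToContinuum.BoseEinsteinCondensation.Theses.BECSubharmonicContinuation.ContinuationToPeriodicBEC := by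
  unfold Summit.AtomisticToContinuum.BoseEinsteinCondensation.Theses.BECSubharmonicContinuation.ContinuationToPeriodicBEC
  intro h1 h2
  unfold Summit.AtomisticToContinuum.BoseEinsteinCondensation.Theses.BECSubharmonicContinuation.PeriodicBEC
  intro v hv
  have hfin : scatteringLength v ≠ ⊤ := hv.scatteringLength_ne_top
  rcases eq_or_ne (scatteringLength v) 0 with ha0 | ha0
  · -- the free case `a = 0`
    exact freeGasCase_proof v hv ha0
  · -- the interacting case `0 < a < ∞`
    have hapos : 0 < scatteringLength v := pos_iff_ne_zero.2 ha0
    have haR : 0 < (scatteringLength v).toReal := ENNReal.toReal_pos ha0 hfin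
    unfold Summit.AtomisticToContinuum.BoseEinsteinCondensation.Theses.BECSubharmonicContinuation.SubharmonicCoherence
      at h1
    unfold Summit.AtomisticToContinuum.BoseEinsteinCondensation.Theses.BECSubharmonicContinuation.HealingScaleDeficit
      at h2
    obtain ⟨M, hM, ρ₁, hρ₁, hS1⟩ := h1 v hv hfin hapos
    obtain ⟨ρ₂, hρ₂, hS2⟩ := h2 v hv hfin hapos M hM (1 / 9216) (by norm_num)
    refine ⟨min ρ₁ ρ₂, lt_min hρ₁ hρ₂, fun ρ hρ hρlt => ⟨1 / 8, by norm_num, ?_⟩⟩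
    -- the healing length `ξ = (8πρa)^{-1/2}` and the core radius `R = Mξ`
    have hξ : 0 < (Real.sqrt (8 * Real.pi * ρ * (scatteringLength v).toReal))⁻¹ :=
      inv_pos.2 (Real.sqrt_pos.2 (by positivity))
    have hR : 0 < M * (Real.sqrt (8 * Real.pi * ρ * (scatteringLength v).toReal))⁻¹ := mul_pos hM hξ
    have e1 := hS1 ρ hρ (hρlt.trans_le (min_le_left _ _))
    have e2 := hS2 ρ hρ (hρlt.trans_le (min_le_right _ _))
    have e3 : ∀ᶠ N : ℕ in atTop,
        2 * (M * (Real.sqrt (8 * Real.pi * ρ * (scatteringLength v).toReal))⁻¹) ≤ sideLength ρ N :=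
      (tendsto_sideLength_atTop hρ).eventually_ge_atTop _
    filter_upwards [e1, e2, e3, eventually_ge_atTop 1] with N hN1 hN2 hN3 hN4
    obtain ⟨δ₁, hδ₁, h1'⟩ := hN1
    obtain ⟨δ₂, hδ₂, h2'⟩ := hN2
    refine ⟨min δ₁ δ₂, lt_min hδ₁ hδ₂, fun Ψ hΨ => ?_⟩
    have hN0 : 0 < N := hN4
    have hL : 0 < sideLength ρ N := by
      unfold sideLength
      exact Real.rpow_pos_of_pos (div_pos (Nat.cast_pos.2 hN0) hρ) _
    set i : Fin N := ⟨0, hN0⟩ with hi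
    have hshell := h1' Ψ (hΨ.trans (add_le_add le_rfl (min_le_left _ _))) i
    have hwin := h2' Ψ (hΨ.trans (add_le_add le_rfl (min_le_right _ _))) i
    have hmain := SubharmonicContinuation.condensateOccupation_ge_of_shell_of_window hL Ψ i hR
      (by linarith) (ε := 1 / 9216) (by norm_num) hshell hwin
    exact hmain

end Summit.AtomisticToContinuum.BoseEinsteinCondensation.Theorems

end
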